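import Summits.QuantumAdvantage.QuantumAdvantage.Theorems.CharDialSchedCounterSubcube
import Summits.QuantumAdvantage.AdviceFreeQNC0.CounterDoob
import HarnessLib

/-!
# R13⊕ on subcubes, REFINED PER FINAL-COUNTER FIBRE (decomp-qadv lens-6 g14, tree part 26a)

The Doob-weighted run (`CounterDoob`: `Φ^h` with a weight HARMONIC for the counter chain) of part 24's scheduled subcube
process (`Theorems.CharDialSchedCounterSubcube[A]`): **`schedSubcubeFib_sharp`** — for `3 ∤ p`, every table source `y`,
schedule `τ`, subcube `{u_W = b_W}`, column `κ` and every final counter value `β ∈ ZMod p`: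
  `#{u : W_n(u') = β ∧ (register, label)_n ∉ L_{(κ,0)}} ≤ (2/3)·#{u : W_n(u') = β} + 4p·2ⁿ·√(12p/(n − |W| + 1))`
(`u' = subcubeMerge W b u`).  Ingredients: `Φ^w` is invariant under alien toggles (`phiW_togSt`) and shifts (`phiW_shift`),
superadditive at averages (`phiW_avg_le`), hence monotone at a scheduled free step for harmonic weights (`phiW_bitT_le`) and
constant at a frozen step for shifted weights; the weight system is harmonic at FREE steps and shifted (`h_t(b) = h_{t+1}(b + b_t)`)
at FROZEN ones (`wB`), ending in the indicator of `β`; martingale identity `sum_weight_ctrT`; part 24's budget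
`exists_D1T_le_free` and label average `l1_lam_le_T` unchanged.
USE (part 26): the memory face E3ʳ of the one-read prefix residual — after time reversal the data are SUFFIX counters, which
on the fibre `W_n ≡ β (p)` are prefix counters; the per-fibre count is exactly this theorem.
WHAT THIS IS NOT: nothing about adaptive (state-dependent) toggles; separation NOT moved.
-/

namespace Summit.QuantumAdvantage.AdviceFreeQNC0

open Finset AffBells22

namespace CounterLaw

/-! ## §1 The weighted functional under alien toggles, shifts and averages -/

section Weighted

variable {p : ℕ} [NeZero p]

/-- **`Φ^w` is invariant under a global alien toggle** of the register. -/
theorem phiW_togSt (w : ZMod p → ℝ) (μ : St p → ℝ) (s : Bool × Bool) :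
    phiW w (fun x => μ (bx x.1 s, x.2.1, x.2.2)) = phiW w μ := by
  by_cases hs : s = (false, false)
  · subst hs; simp only [bx_zero]
  · obtain ⟨a', ha'⟩ := exists_tog_of_ne_zero s hs
    simp only [ha']
    unfold phiW
    refine sum_congr rfl fun b _ => ?_
    congr 1
    simp only [mass_alienTog]
    exact inf'_comp_equiv ⟨(0, none), mem_univ _⟩ (alienEquiv a') (fun i => mass μ i b)

/-- **`Φ^w` under a shift** of label and counter: the weight is translated. -/
theorem phiW_shift (w : ZMod p → ℝ) (μ : St p → ℝ) (k : ZMod 3) (j : ZMod p) :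
    phiW w (fun x : St p => μ (x.1, x.2.1 - k, x.2.2 - j)) = phiW (fun b => w (b + j)) μ := by
  unfold phiW
  have hm : ∀ i b', mass (fun x : St p => μ (x.1, x.2.1 - k, x.2.2 - j)) i b' = mass μ (shEquiv k i) (b' - j) := by
    intro i b'
    show _ = mass μ (shIdx k i) (b' - j)
    rw [← mass_shift μ k i (b' - j)]
    simp only [mass]
  simp only [hm]
  have e1 : ∀ b' : ZMod p, (univ : Finset Idx).inf' ⟨(0, none), mem_univ _⟩ (fun i => mass μ (shEquiv k i) (b' - j))
      = (univ : Finset Idx).inf' ⟨(0, none), mem_univ _⟩ (fun i => mass μ i (b' - j)) :=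
    fun b' => inf'_comp_equiv _ (shEquiv k) (fun i => mass μ i (b' - j))
  simp only [e1]
  conv_rhs => rw [← Equiv.sum_comp (Equiv.subRight j)
    (fun b' => w (b' + j) * (univ : Finset Idx).inf' ⟨(0, none), mem_univ _⟩ fun i => mass μ i b')]
  refine sum_congr rfl fun b' _ => ?_
  simp

/-- `Φ^w` is superadditive at averages (`w ≥ 0`). -/
theorem phiW_avg_le (w : ZMod p → ℝ) (hw : ∀ b, 0 ≤ w b) (f g : St p → ℝ) :
    (phiW w f + phiW w g) / 2 ≤ phiW w (fun x => (f x + g x) / 2) := by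
  unfold phiW
  rw [← sum_add_distrib, sum_div]
  refine sum_le_sum fun b _ => ?_
  rw [← mul_add, mul_div_assoc]
  refine mul_le_mul_of_nonneg_left ?_ (hw b)
  refine Finset.le_inf' _ _ fun i _ => ?_
  rw [mass_avg]
  have h1 := inf'_le (fun i => mass f i b) (mem_univ i)
  have h2 := inf'_le (fun i => mass g i b) (mem_univ i)
  linarith

/-- **`Φ^w` does not decrease at a scheduled free step** for a harmonic weight (`w = ½(w' + w'(·+1))`, `w' ≥ 0`). -/
theorem phiW_bitT_le (w w' : ZMod p → ℝ) (hw' : ∀ b, 0 ≤ w' b) (hh : ∀ b, w b = (w' b + w' (b + 1)) / 2)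
    (μ : St p → ℝ) (s : Bool × Bool) :
    phiW w μ ≤ phiW w' (fun x : St p => (μ (x.1, x.2.1 - 1, x.2.2) + μ (bx x.1 s, x.2.1 - 2, x.2.2 - 1)) / 2) := by
  have hf : phiW w' (fun x : St p => μ (x.1, x.2.1 - 1, x.2.2)) = phiW w' μ := by
    have := phiW_shift w' μ 1 0
    simpa using this
  have hg : phiW w' (fun x : St p => μ (bx x.1 s, x.2.1 - 2, x.2.2 - 1)) = phiW (fun b => w' (b + 1)) μ := by
    rw [← phiW_togSt (fun b => w' (b + 1)) μ s]
    exact phiW_shift w' (fun z : St p => μ (bx z.1 s, z.2.1, z.2.2)) 2 1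
  have havg := phiW_avg_le w' hw' (fun x : St p => μ (x.1, x.2.1 - 1, x.2.2))
    (fun x : St p => μ (bx x.1 s, x.2.1 - 2, x.2.2 - 1))
  rw [hf, hg] at havg
  have hsum : phiW w μ = (phiW w' μ + phiW (fun b => w' (b + 1)) μ) / 2 := by
    unfold phiW
    rw [← sum_add_distrib, sum_div]
    refine sum_congr rfl fun b _ => ?_
    rw [hh b]; ring
  rw [hsum]; exact havg

end Weighted

/-! ## §2 `Φ^h` along the scheduled subcube process -/

section Process

variable {n : ℕ} (p : ℕ) [NeZero p] (y : Fin (n + 1) → (Fin n → Bool) → Bool) (τ : Fin n → Bool × Bool)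
  (W : Finset (Fin n)) (b : Fin n → Bool)

/-- **monotonicity**: for a weight system HARMONIC at free steps and SHIFTED at frozen steps, `Φ^{h_t}(lawTp t)` does not
decrease. -/
theorem phiW_lawTp_mono (h : ℕ → ZMod p → ℝ)
    (hfree : ∀ t : Fin n, t ∉ W → ∀ b', h t.val b' = (h (t.val + 1) b' + h (t.val + 1) (b' + 1)) / 2)
    (hfroz : ∀ t : Fin n, t ∈ W → ∀ b', h t.val b' = h (t.val + 1) (b' + (((b t).toNat : ℕ) : ZMod p)))
    (h0 : ∀ t b', 0 ≤ h t b') {t s : ℕ} (hts : t ≤ s) (hs : s ≤ n) :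
    phiW (h t) (lawTp p y τ W b t) ≤ phiW (h s) (lawTp p y τ W b s) := by
  induction s, hts using Nat.le_induction with
  | base => exact le_rfl
  | succ s hts ih =>
    have hsn : s < n := hs
    refine (ih hsn.le).trans ?_
    have hbit : phiW (h s) (lawTp p y τ W b s) ≤ phiW (h (s + 1)) (lawT p y τ W b (s + 1)) := by
      by_cases hW : (⟨s, hsn⟩ : Fin n) ∈ W
      · have hfun : lawT p y τ W b (s + 1) = fun x : St p =>
            (fun z : St p => lawTp p y τ W b s (bx z.1 (if b ⟨s, hsn⟩ then τ ⟨s, hsn⟩ else (false, false)), z.2.1, z.2.2))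
              (x.1, x.2.1 - ((1 + (b ⟨s, hsn⟩).toNat : ℕ) : ZMod 3), x.2.2 - (((b ⟨s, hsn⟩).toNat : ℕ) : ZMod p)) := by
          funext x
          rw [lawT_succ_frozen p y τ W b ⟨s, hsn⟩ hW x]
          simp only [togSt_symm_apply, bitEq_symm_apply]
        rw [hfun, phiW_shift (h (s + 1)) (fun z : St p =>
          lawTp p y τ W b s (bx z.1 (if b ⟨s, hsn⟩ then τ ⟨s, hsn⟩ else (false, false)), z.2.1, z.2.2)), phiW_togSt]
        have hw : (fun b' => h (s + 1) (b' + (((b ⟨s, hsn⟩).toNat : ℕ) : ZMod p))) = h s :=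
          funext fun b' => (hfroz ⟨s, hsn⟩ hW b').symm
        rw [hw]
      · have hle := phiW_bitT_le (h s) (h (s + 1)) (h0 (s + 1)) (hfree ⟨s, hsn⟩ hW) (lawTp p y τ W b s) (τ ⟨s, hsn⟩)
        have e : (fun x : St p =>
            (lawTp p y τ W b s (x.1, x.2.1 - 1, x.2.2) + lawTp p y τ W b s (bx x.1 (τ ⟨s, hsn⟩), x.2.1 - 2, x.2.2 - 1)) / 2)
            = lawT p y τ W b (s + 1) := by
          funext x; exact (lawT_succ_free' p y τ W b ⟨s, hsn⟩ hW x).symm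
        rwa [e] at hle
    have hfire : phiW (h (s + 1)) (lawTp p y τ W b (s + 1)) = phiW (h (s + 1)) (lawT p y τ W b (s + 1)) := by
      have e : lawTp p y τ W b (s + 1) = fun x : St p =>
          lawT p y τ W b (s + 1) (if tabN p y (s + 1) x.2.2 then tog x.2.1 x.1 else x.1, x.2.1, x.2.2) := by
        funext x; exact lawTp_eq p y τ W b (s + 1) x
      rw [e]; exact phiW_fire (h (s + 1)) (lawT p y τ W b (s + 1)) (tabN p y (s + 1))
    rw [hfire]; exact hbit

/-- `Φ^w(lawTp t) ≥ ⅓·Σ_b w(b)·fib_b(lawTp t) − 2p·D1T(s)(lawTp t)` for weights `0 ≤ w ≤ 1` and every alien toggle `s`. -/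
theorem phiW_lawTp_ge (h3 : ¬ 3 ∣ p) (s : Bool × Bool) (t : ℕ) (w : ZMod p → ℝ) (hw0 : ∀ b', 0 ≤ w b')
    (hw1 : ∀ b', w b' ≤ 1) :
    (∑ b', w b' * fib (lawTp p y τ W b t) b') / 3 - 2 * p * D1T p s (lawTp p y τ W b t)
      ≤ phiW w (lawTp p y τ W b t) := by
  have hthird : (∑ b', w b' * fib (lawTp p y τ W b t) b') / 3 ≤ phiW w (lam p (lawTp p y τ W b t)) := by
    have e : ∑ b', w b' * fib (lawTp p y τ W b t) b' = ∑ b', w b' * fib (lam p (lawTp p y τ W b t)) b' :=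
      sum_congr rfl fun b' _ => by rw [fib_lam]
    rw [e]
    refine phiW_ge_third w hw0 _ (fun x => ?_) (fun g a b' => lam_const p h3 _ g a b')
    have h0 := lawTp_nonneg p y τ W b t
    exact div_nonneg (add_nonneg (add_nonneg (h0 _) (h0 _)) (h0 _)) (by norm_num)
  have hlip := abs_phiW_sub_phiW_le w (fun b' => by rw [abs_of_nonneg (hw0 b')]; exact hw1 b')
    (lawTp p y τ W b t) (lam p (lawTp p y τ W b t))
  have hl := l1_lam_le_T p s (lawTp p y τ W b t)
  rw [abs_le] at hlip
  linarith [hlip.1]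

omit [NeZero p] in
/-- fibre masses of `lawTp t` count the merged inputs by their counter. -/
theorem fib_lawTp (t : ℕ) (β : ZMod p) :
    fib (lawTp p y τ W b t) β = ((univ.filter fun u : Fin n → Bool => ctrN p (subcubeMerge W b u) t = β).card : ℝ) := by
  unfold fib lawTp
  have hfib := card_eq_sum_card_fiberwise (s := univ.filter fun u : Fin n → Bool => ctrN p (subcubeMerge W b u) t = β)
    (t := (univ : Finset ((Bool × Bool) × ZMod 3)))
    (f := fun u => ((XTp p y τ (subcubeMerge W b u) t).1, (XTp p y τ (subcubeMerge W b u) t).2.1)) (fun u _ => mem_univ _)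
  rw [hfib, Nat.cast_sum, Fintype.sum_prod_type (f := fun ga : (Bool × Bool) × ZMod 3 =>
    (((univ.filter fun u : Fin n → Bool => ctrN p (subcubeMerge W b u) t = β).filter fun u =>
      ((XTp p y τ (subcubeMerge W b u) t).1, (XTp p y τ (subcubeMerge W b u) t).2.1) = ga).card : ℝ))]
  refine sum_congr rfl fun g _ => sum_congr rfl fun a _ => ?_
  congr 2
  ext u
  simp only [mem_filter, mem_univ, true_and, XTp, Prod.mk.injEq]
  tauto

/-- `Σ_b w(b)·fib_b = Σ_u w(W_{<t}(u'))`. -/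
theorem sum_weight_fib_lawTp (w : ZMod p → ℝ) (t : ℕ) :
    ∑ b', w b' * fib (lawTp p y τ W b t) b' = ∑ u : Fin n → Bool, w (ctrN p (subcubeMerge W b u) t) := by
  simp only [fib_lawTp]
  rw [← Finset.sum_fiberwise (univ : Finset (Fin n → Bool)) (fun u : Fin n → Bool => ctrN p (subcubeMerge W b u) t)
    (fun u : Fin n → Bool => w (ctrN p (subcubeMerge W b u) t))]
  refine sum_congr rfl fun b' _ => ?_
  rw [sum_congr rfl fun u hu => by rw [(mem_filter.mp hu).2], sum_const, nsmul_eq_mul, mul_comm]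

omit [NeZero p] in
/-- **martingale step on the subcube**: free steps average, frozen steps shift. -/
theorem sum_weight_ctrT_succ (h : ℕ → ZMod p → ℝ)
    (hfree : ∀ t : Fin n, t ∉ W → ∀ b', h t.val b' = (h (t.val + 1) b' + h (t.val + 1) (b' + 1)) / 2)
    (hfroz : ∀ t : Fin n, t ∈ W → ∀ b', h t.val b' = h (t.val + 1) (b' + (((b t).toNat : ℕ) : ZMod p)))
    (t : Fin n) :
    ∑ u : Fin n → Bool, h (t.val + 1) (ctrN p (subcubeMerge W b u) (t.val + 1))
      = ∑ u : Fin n → Bool, h t.val (ctrN p (subcubeMerge W b u) t.val) := by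
  have hstep : ∀ u : Fin n → Bool, ctrN p (subcubeMerge W b u) (t.val + 1)
      = ctrN p (subcubeMerge W b u) t.val + (((subcubeMerge W b u t).toNat : ℕ) : ZMod p) := by
    intro u; unfold ctrN; rw [wtPrefix_succ_eq]; push_cast; ring
  by_cases hW : t ∈ W
  · refine sum_congr rfl fun u _ => ?_
    rw [hstep, merge_apply_frozen W b u hW, hfroz t hW]
  · have hinv : ∀ (u : Fin n → Bool) (β : Bool),
        ctrN p (subcubeMerge W b (Function.update u t β)) t.val = ctrN p (subcubeMerge W b u) t.val := by
      intro u β; unfold ctrN; rw [merge_update_free W b u hW, wtPrefix_update_of_le _ t β le_rfl]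
    rw [← sum_filter_add_sum_filter_not univ (fun u : Fin n → Bool => u t = false)]
    have e1 : ∑ u ∈ univ.filter (fun u : Fin n → Bool => u t = false), h (t.val + 1) (ctrN p (subcubeMerge W b u) (t.val + 1))
        = ∑ u ∈ univ.filter (fun u : Fin n → Bool => u t = false), h (t.val + 1) (ctrN p (subcubeMerge W b u) t.val) := by
      refine sum_congr rfl fun u hu => ?_
      simp only [mem_filter, mem_univ, true_and] at hu
      rw [hstep, merge_apply_free W b u hW, hu]; simp
    have e2 : ∑ u ∈ univ.filter (fun u : Fin n → Bool => ¬ u t = false), h (t.val + 1) (ctrN p (subcubeMerge W b u) (t.val + 1))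
        = ∑ u ∈ univ.filter (fun u : Fin n → Bool => u t = true), h (t.val + 1) (ctrN p (subcubeMerge W b u) t.val + 1) := by
      have : (univ.filter fun u : Fin n → Bool => ¬ u t = false) = univ.filter fun u : Fin n → Bool => u t = true := by
        congr 1; ext u; simp
      rw [this]
      refine sum_congr rfl fun u hu => ?_
      simp only [mem_filter, mem_univ, true_and] at hu
      rw [hstep, merge_apply_free W b u hW, hu]; simp
    rw [e1, e2, sum_filter_bit_eq_half t false (fun u => h (t.val + 1) (ctrN p (subcubeMerge W b u) t.val))
        (fun u β => by simp only [hinv]),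
      sum_filter_bit_eq_half t true (fun u => h (t.val + 1) (ctrN p (subcubeMerge W b u) t.val + 1))
        (fun u β => by simp only [hinv]),
      ← add_div, ← sum_add_distrib, sum_div]
    exact sum_congr rfl fun u _ => (hfree t hW _).symm

omit [NeZero p] in
/-- the martingale identity iterated. -/
theorem sum_weight_ctrT (h : ℕ → ZMod p → ℝ)
    (hfree : ∀ t : Fin n, t ∉ W → ∀ b', h t.val b' = (h (t.val + 1) b' + h (t.val + 1) (b' + 1)) / 2)
    (hfroz : ∀ t : Fin n, t ∈ W → ∀ b', h t.val b' = h (t.val + 1) (b' + (((b t).toNat : ℕ) : ZMod p)))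
    {t s : ℕ} (hts : t ≤ s) (hs : s ≤ n) :
    ∑ u : Fin n → Bool, h t (ctrN p (subcubeMerge W b u) t) = ∑ u : Fin n → Bool, h s (ctrN p (subcubeMerge W b u) s) := by
  induction s, hts using Nat.le_induction with
  | base => rfl
  | succ s hts ih =>
    have hsn : s < n := hs
    rw [ih hsn.le]
    exact (sum_weight_ctrT_succ p W b h hfree hfroz ⟨s, hsn⟩).symm


end Process
end CounterLaw
end Summit.QuantumAdvantage.AdviceFreeQNC0
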